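import Summits.AtomisticToContinuum.FouriersLaw.Theorems.LatticeLandauDampingAbelThermodynamicLimitBulkWindowEquivalence

/-!
# Leaf (B₀) `stub_fixedTimeOffsetMatching` of S4: the STATIC half `stub_centralWindowEnsembleEquivalence` — PROVED
(crux `EmbeddedDrudeMourre.AbelThermodynamicLimit`, item stmt-AtomisticToContinuum-12596, line
`loomis-compact-horizon-witness`; `--supports` file proving the registered sub-goal `stub_centralWindowEnsembleEquivalence`
VERBATIM; closes nothing)

The registered static half of (B₀): for `P = pinnedChain ω₂ lam β γ` (all `> 0`), `T > 0`, a shift-invariant DLR state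
`μT`, the CENTRED EMBEDDING `ι_N : PhaseSpace N → (ℤ → ℝ × ℝ)` (site `k` at `k - c_N`, `c_N = ⌊(N-1)/2⌋`, zero off the
chain; entered through its defining equation) and every measurable event `A` read on a window `{a, …, a+n}`:
`gibbsMeasure N T (ι_N⁻¹ A) → μT(A)` — the one-dimensional EQUIVALENCE OF ENSEMBLES for central windows of the
free-boundary Gibbs measures.

It is a corollary of the twin line's anchor-uniform bulk equivalence of ensembles for window events
(`SeriesLawAtEveryLaplaceFrequency.BulkWindow.pinnedChain_bulkWindow_event`, item stmt-AtomisticToContinuum-14013: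
free finite Gibbs measures are DLR in the bulk, window kernels forget bounded far boundary data uniformly — transfer
operator —, `N`-uniform one-site tails, tightness of shift-invariant states): a window event `A` is the pull-back of a
measurable `B ⊆ PhaseSpace (n+1)` under `boxPhaseAt a n` (§1, by `DependsOn`), its `ι_N`-preimage is the window
`[a + c_N, a + c_N + n]` of the finite chain read in `B` (§2), `μT(A) = μT(boxPhaseAt 0 n ∈ B)` by shift invariance,
and the anchor `a + c_N` is eventually `L`-deep (§3).

All statements proved; `[folklore]`. No definitions.
-/

noncomputable section

namespace Summit.AtomisticToContinuum.FouriersLaw.Theorems.AbelThermodynamicLimit.LoomisCompactHorizonWitness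

open MeasureTheory Set Filter Topology Function
open scoped ENNReal
open Literature.MathematicalPhysics.KineticTheory.HeatConduction OscillatorChain
open Summit.AtomisticToContinuum.FouriersLaw.Theorems.AbelThermodynamicLimit.SeriesLawAtEveryLaplaceFrequency

/-! ### §1 Window events are pull-backs under `boxPhaseAt` -/

section WindowEvent

/-- **A window event is a pull-back under the window map.** If the indicator of the measurable `A` depends only on
the coordinates in `{a, …, a+n}`, then `A = (boxPhaseAt a n)⁻¹ B` for a measurable `B ⊆ PhaseSpace (n+1)` (namely the
window data whose zero extension lies in `A`). [folklore] -/
theorem exists_eq_preimage_boxPhaseAt_of_dependsOn (a : ℤ) (n : ℕ) {A : Set ChainConfig} (hA : MeasurableSet A)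
    (hAd : DependsOn (A.indicator (1 : ChainConfig → ℝ≥0∞)) (↑(Finset.Icc a (a + n)) : Set ℤ)) :
    ∃ B : Set (PhaseSpace (n + 1)), MeasurableSet B ∧ A = (boxPhaseAt a n) ⁻¹' B := by
  -- the zero extension of window data
  set ext : PhaseSpace (n + 1) → ChainConfig := fun w x =>
    if h : a ≤ x ∧ x ≤ a + n then (w.1 ⟨(x - a).toNat, by omega⟩, w.2 ⟨(x - a).toNat, by omega⟩) else (0, 0)
    with hext
  have hextm : Measurable ext := by
    refine measurable_pi_lambda _ fun x => ?_
    by_cases h : a ≤ x ∧ x ≤ a + n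
    · have e : (fun w : PhaseSpace (n + 1) => ext w x) =
          fun w => (w.1 ⟨(x - a).toNat, by omega⟩, w.2 ⟨(x - a).toNat, by omega⟩) := funext fun w => dif_pos h
      rw [e]; fun_prop
    · have e : (fun w : PhaseSpace (n + 1) => ext w x) = fun _ => ((0 : ℝ), (0 : ℝ)) := funext fun w => dif_neg h
      rw [e]; exact measurable_const
  refine ⟨ext ⁻¹' A, hextm hA, Set.ext fun σ => ?_⟩
  -- `ext (boxPhaseAt a n σ)` agrees with `σ` on the window
  have hagree : ∀ x ∈ (↑(Finset.Icc a (a + n)) : Set ℤ), σ x = ext (boxPhaseAt a n σ) x := by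
    intro x hx
    simp only [Finset.coe_Icc, Set.mem_Icc] at hx
    have h : a ≤ x ∧ x ≤ a + n := hx
    simp only [hext, dif_pos h, boxPhaseAt_fst, boxPhaseAt_snd]
    have e : a + (((x - a).toNat : ℕ) : ℤ) = x := by omega
    have e' : a + ((⟨(x - a).toNat, by omega⟩ : Fin (n + 1)) : ℤ) = x := by simpa using e
    rw [e']
  have hind := hAd hagree
  simp only [Set.mem_preimage]
  constructor
  · intro hσ
    by_contra h
    rw [Set.indicator_of_mem hσ, Set.indicator_of_notMem h] at hind
    exact one_ne_zero hind
  · intro hσ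
    by_contra h
    rw [Set.indicator_of_notMem h, Set.indicator_of_mem hσ] at hind
    exact zero_ne_one hind

end WindowEvent

/-! ### §2 The `ι_N`-preimage of a window event is a finite-chain window event -/

section Preimage

variable {N : ℕ}

/-- The window map `boxPhaseAt a n` after the centred embedding reads the finite window `[a + c_N, a + c_N + n]`
(when it lies inside the chain). [folklore] -/
theorem boxPhaseAt_centredEmbedding (ι : (N : ℕ) → PhaseSpace N → ChainConfig)
    (hι : ∀ (N : ℕ) (z : PhaseSpace N) (i : ℤ), ι N z i =
      if h : 0 ≤ i + ((N - 1) / 2 : ℕ) ∧ i + ((N - 1) / 2 : ℕ) < N then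
        (z.1 ⟨(i + ((N - 1) / 2 : ℕ)).toNat, by omega⟩, z.2 ⟨(i + ((N - 1) / 2 : ℕ)).toNat, by omega⟩)
      else (0, 0)) (a : ℤ) (n : ℕ) (i : Fin N) (hia : (i.val : ℤ) = a + ((N - 1) / 2 : ℕ))
    (hin : i.val + n < N) (z : PhaseSpace N) :
    boxPhaseAt a n (ι N z) = ((fun j : Fin (n + 1) => z.1 ⟨i.val + j.val, by omega⟩,
      fun j : Fin (n + 1) => z.2 ⟨i.val + j.val, by omega⟩) : PhaseSpace (n + 1)) := by
  have h : ∀ j : Fin (n + 1), ι N z (a + ((j : ℕ) : ℤ)) = (z.1 ⟨i.val + j.val, by omega⟩, z.2 ⟨i.val + j.val, by omega⟩) := by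
    intro j
    rw [hι]
    have hr : 0 ≤ a + ((j : ℕ) : ℤ) + ((N - 1) / 2 : ℕ) ∧ a + ((j : ℕ) : ℤ) + ((N - 1) / 2 : ℕ) < N := by
      constructor <;> omega
    rw [dif_pos hr]
    have e : (⟨(a + ((j : ℕ) : ℤ) + ((N - 1) / 2 : ℕ)).toNat, by omega⟩ : Fin N) = ⟨i.val + j.val, by omega⟩ := by
      ext; simp only; omega
    rw [e]
  refine Prod.ext (funext fun j => ?_) (funext fun j => ?_)
  · rw [boxPhaseAt_fst, h]
  · rw [boxPhaseAt_snd, h]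

end Preimage

/-! ### §3 The static half -/

/-- **Registered static half `stub_centralWindowEnsembleEquivalence` of leaf (B₀), line `loomis-compact-horizon-witness`
— EQUIVALENCE OF ENSEMBLES ON CENTRAL WINDOWS.** For the pinned anharmonic chain (all parameters `> 0`), `T > 0`, a
shift-invariant DLR state `μT` and the centred embedding `ι_N`, the laws of `ι_N z`, `z ∼ gibbsMeasure N T`, converge
setwise on window events to `μT`: a corollary of the anchor-uniform bulk equivalence for window events of the twin
line (`BulkWindow.pinnedChain_bulkWindow_event`), the anchor `a + c_N` of the window `{a,…,a+n}` being eventually deep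
and `μT` shift-invariant. [folklore] -/
theorem stub_centralWindowEnsembleEquivalence :
    ∀ ω₂ lam β γ : ℝ, 0 < ω₂ → 0 < lam → 0 < β → 0 < γ → ∀ T : ℝ, 0 < T →
      ∀ (μT : MeasureTheory.Measure Literature.MathematicalPhysics.KineticTheory.HeatConduction.ChainConfig),
        (Literature.MathematicalPhysics.KineticTheory.HeatConduction.pinnedChain ω₂ lam β γ).IsChainGibbsMeasure T μT →
        Literature.MathematicalPhysics.KineticTheory.HeatConduction.IsShiftInvariant μT →
      ∀ ι : (N : ℕ) → Literature.MathematicalPhysics.KineticTheory.HeatConduction.PhaseSpace N →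
          Literature.MathematicalPhysics.KineticTheory.HeatConduction.ChainConfig,
        (∀ (N : ℕ) (z : Literature.MathematicalPhysics.KineticTheory.HeatConduction.PhaseSpace N) (i : ℤ),
          ι N z i = if h : 0 ≤ i + ((N - 1) / 2 : ℕ) ∧ i + ((N - 1) / 2 : ℕ) < N then
            (z.1 ⟨(i + ((N - 1) / 2 : ℕ)).toNat, by omega⟩, z.2 ⟨(i + ((N - 1) / 2 : ℕ)).toNat, by omega⟩)
            else (0, 0)) →
      ∀ (a : ℤ) (n : ℕ) (A : Set Literature.MathematicalPhysics.KineticTheory.HeatConduction.ChainConfig),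
        MeasurableSet A →
        DependsOn (A.indicator (1 : Literature.MathematicalPhysics.KineticTheory.HeatConduction.ChainConfig → ENNReal))
          (↑(Finset.Icc a (a + n)) : Set ℤ) →
        Filter.Tendsto (fun N : ℕ =>
            ((Literature.MathematicalPhysics.KineticTheory.HeatConduction.pinnedChain ω₂ lam β γ).gibbsMeasure N T).real
              ((ι N) ⁻¹' A))
          Filter.atTop (nhds (μT.real A))  := by
  intro ω₂ lam β γ hω hl hβ hγ T hT μT hG hS ι hι a n A hA hAd
  haveI : IsProbabilityMeasure μT := hG.1
  haveI hμN : ∀ N : ℕ, IsProbabilityMeasure ((pinnedChain ω₂ lam β γ).gibbsMeasure N T) := fun N =>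
    pinnedChain_isProbabilityMeasure_gibbsMeasure hω hl.le hβ.le γ N hT
  obtain ⟨B, hB, hAB⟩ := exists_eq_preimage_boxPhaseAt_of_dependsOn a n hA hAd
  -- shift invariance: `μT(A) = μT(boxPhaseAt 0 n ∈ B)`
  have hμT : μT.real A = μT.real {σ | boxPhaseAt 0 n σ ∈ B} := by
    rw [hAB, measureReal_def, measureReal_def, ← Measure.map_apply (measurable_boxPhaseAt a n) hB,
      map_boxPhaseAt_eq_zero_of_map_shift hS a n, Measure.map_apply (measurable_boxPhaseAt 0 n) hB]
    rfl
  rw [hμT, Metric.tendsto_atTop]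
  intro δ hδ
  obtain ⟨L, N₀, h⟩ := BulkWindow.pinnedChain_bulkWindow_event γ hω hl.le hβ.le hT hG hS n hB (half_pos hδ)
  refine ⟨max N₀ (2 * (L + a.natAbs + n) + 2), fun N hN => ?_⟩
  have hN₀ : N₀ ≤ N := le_trans (le_max_left _ _) hN
  have hN₁ : 2 * (L + a.natAbs + n) + 2 ≤ N := le_trans (le_max_right _ _) hN
  -- the anchor `a + c_N`
  have hi0 : 0 ≤ a + ((N - 1) / 2 : ℕ) := by omega
  set i : Fin N := ⟨(a + ((N - 1) / 2 : ℕ)).toNat, by omega⟩ with hidef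
  have hia : (i.val : ℤ) = a + ((N - 1) / 2 : ℕ) := by simp only [hidef]; omega
  have hL : L ≤ i.val := by
    have : (L : ℤ) ≤ (i.val : ℤ) := by rw [hia]; omega
    exact_mod_cast this
  have hi : i.val + n + L < N := by
    have : (i.val : ℤ) + n + L < N := by rw [hia]; omega
    exact_mod_cast this
  have hset : (ι N) ⁻¹' A = {z : PhaseSpace N | ((fun j : Fin (n + 1) => z.1 ⟨i.val + j.val, by omega⟩,
      fun j : Fin (n + 1) => z.2 ⟨i.val + j.val, by omega⟩) : PhaseSpace (n + 1)) ∈ B} := by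
    ext z
    simp only [Set.mem_preimage, Set.mem_setOf_eq, hAB]
    rw [boxPhaseAt_centredEmbedding ι hι a n i hia (by omega) z]
  rw [Real.dist_eq, hset]
  exact lt_of_le_of_lt (h N hN₀ i hL hi) (half_lt_self hδ)

end Summit.AtomisticToContinuum.FouriersLaw.Theorems.AbelThermodynamicLimit.LoomisCompactHorizonWitness

end
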